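import Literature.NumberTheory.Automorphic.ReciprocityGLnProofs
import Literature.NumberTheory.GaloisRepresentations.LAdicRepFrobenius
import HarnessLib

/-!
# Harris–Lan–Taylor–Thorne 2016, Thm. A: the uniqueness clause, proved

Topic `Literature/NumberTheory/Automorphic`.  A *proofs* file (theorems only) next to
`ReciprocityGLnProofs`, which vendors the top layer of lang.S27
(`exists_galoisRep_of_regularAlgebraic`): Harris–Lan–Taylor–Thorne's Thm. A as the two named
facts `HarrisLanTaylorThorne2016.theoremA_existence` / `theoremA_uniqueness` and Varma's
Cor. 9.3.  Here the **uniqueness clause of Thm. A is proved**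
(`HarrisLanTaylorThorne2016.theoremA_uniqueness_of`) modulo two standard named facts of the
tree:

* Chebotarev's density theorem in the Artin-representation existence form
  `Literature.NumberTheory.Automorphic.chebotarev_artinRep` (`TunnellLemma`, after Tate, *Global class field theory* §2.4),
  through the density of Frobenius elements (`GaloisRepresentations/FrobeniusDensity`) and the
  uniqueness of semisimple Galois representations with prescribed Frobenius characteristic
  polynomials (`GaloisRepresentations/LAdicRepFrobenius`, Chebotarev + Brauer–Nesbitt in
  characteristic `0`, `RepresentationTheory/Semisimple/EquivOfCharacter` — all proved);
* Flath's "automorphic representations are unramified almost everywhere",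
  `AutomorphicRepData.hasSatakeParamAt_cofinite` (hypothesis `hcof`, for every `π`).

Argument (HLTT, p. 3, state uniqueness without comment; it is the classical one of
Deligne–Serre 1974, Lemme 3.2): two continuous semisimple `r, r'` with HLTT's property
(`IsCompatible π ι ·`) are unramified with the same characteristic polynomial of Frobenius —
that predicted by the Satake parameter — at every place `v` over a rational prime `q ≠ ℓ` above
which `π` is unramified; the remaining places lie over `ℓ` or over a rational prime below one
of the finitely many ramified places of `π`, a finite set (`exists_natPrime_natCast_mem`,
`natPrime_eq_of_natCast_mem` of `ReciprocityGLnProofs`, Mathlib `Ideal.finite_factors`); so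
`FramedGaloisRep.nonempty_equiv_of_hasFrobCharpolyAt_eventually` applies.  With this file,
lower layer 1 of the module docstring of `ReciprocityGLnProofs` is **done**; layer 2 (existence)
is being decomposed in `GaloisRepresentations/TwistedSumDecomposition` (HLTT Prop. 7.12) and
`Automorphic/HarrisLanTaylorThorneCor627` (HLTT Cor. 6.27).

Bibliographic note requested by the review of `ReciprocityGLnProofs` (p10866): the Varma
locators used there (Thm. 1–2 p. 2, Def. 8.2, Thm. 9.2 pp. 30–31, Cor. 9.3 p. 32) are those of
the published version, Forum Math. Sigma 12 (2024) e21 (held); in the held preprint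
arXiv:1411.2520v1 (25 pp.) the numbering differs: Thm. 1–2 = "Theorem (1^{ss})" and
"Theorem (1)" (p. 3), Cor. 9.3 = Cor. 10.3 (p. 24).

## References

* M. Harris, K.-W. Lan, R. Taylor, J. Thorne, *On the rigid cohomology of certain Shimura
  varieties*, Res. Math. Sci. 3:37 (2016), Thm. A (p. 3). [HarrisLanTaylorThorneRMS2016]
* P. Deligne, J.-P. Serre, *Formes modulaires de poids 1*, Ann. Sci. ÉNS 7 (1974), Lemme 3.2
  (p. 513). [DeligneSerreASENS1974]
* D. Flath, *Decomposition of representations into tensor products*, Corvallis (1979), Thm. 3.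
  [Flath1979]
-/

noncomputable section

open scoped MatrixGroups Matrix Classical Polynomial NumberField
open NumberField IsDedekindDomain Field Polynomial Literature.NumberTheory.Automorphic

namespace Literature.NumberTheory.Automorphic

/-! ## Uniqueness in Thm. A from Chebotarev and Brauer–Nesbitt -/

namespace HarrisLanTaylorThorne2016

/-- **Harris–Lan–Taylor–Thorne 2016, Thm. A — uniqueness, proved** modulo Chebotarev's density
theorem (`chebotarev_artinRep`) and Flath's "automorphic representations are
unramified almost everywhere" (`AutomorphicRepData.hasSatakeParamAt_cofinite`, hypothesis
`hcof` for all `π`): two continuous semisimple `r, r'` with HLTT's property for `π` agree, at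
every place `v` over a rational prime `q ≠ ℓ` above which `π` is unramified, on unramifiedness
and on the characteristic polynomial of Frobenius (that of the Satake parameter of `π_v`); the
remaining places lie over `ℓ` or over a rational prime below one of the finitely many ramified
places of `π` (`exists_natPrime_natCast_mem`, `natPrime_eq_of_natCast_mem`, Mathlib
`Ideal.finite_factors`), a finite set; conclude by
`FramedGaloisRep.nonempty_equiv_of_hasFrobCharpolyAt_eventually` (Frobenius density +
Brauer–Nesbitt). [cite: HarrisLanTaylorThorneRMS2016, Thm. A (p. 3), uniqueness clause] -/
theorem theoremA_uniqueness_of (hC : chebotarev_artinRep)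
    (hcof : ∀ {n : ℕ} {K : Type} [Field K] [NumberField K]
      {hcpt : isCompact_glFiniteIntegralLevel n K}
      (π : AutomorphicRepData (AutomorphyDatum.gl n K hcpt)), π.hasSatakeParamAt_cofinite) :
    theoremA_uniqueness := by
  intro n K _ _ hcpt hK π hπ ℓ _ ι r r' hr hr' hc hc'
  refine GaloisRepresentations.FramedGaloisRep.nonempty_equiv_of_hasFrobCharpolyAt_eventually hC r r' hr hr' ?_
  -- bad places: those over `ℓ`, and those over a rational prime below a ramified place of `π`
  have hB : {w : HeightOneSpectrum (𝓞 K) | ¬ π.1.IsUnramifiedAt w}.Finite := hcof π.1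
  choose f hf using fun w : HeightOneSpectrum (𝓞 K) ↦ exists_natPrime_natCast_mem w
  have hfinite : ∀ {p : ℕ}, p ≠ 0 →
      {v : HeightOneSpectrum (𝓞 K) | ((p : ℕ) : 𝓞 K) ∈ v.asIdeal}.Finite := by
    intro p hp
    have hne : Ideal.span {((p : ℕ) : 𝓞 K)} ≠ ⊥ := by
      rw [Ne, Ideal.span_singleton_eq_bot]
      exact_mod_cast hp
    convert Ideal.finite_factors hne using 2 with v
    simp [Ideal.dvd_span_singleton]
  have hSℓ : {v : HeightOneSpectrum (𝓞 K) | ((ℓ : ℕ) : 𝓞 K) ∈ v.asIdeal}.Finite :=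
    hfinite (Fact.out : ℓ.Prime).ne_zero
  have hSB : (⋃ w ∈ {w : HeightOneSpectrum (𝓞 K) | ¬ π.1.IsUnramifiedAt w},
      {v : HeightOneSpectrum (𝓞 K) | ((f w : ℕ) : 𝓞 K) ∈ v.asIdeal}).Finite :=
    hB.biUnion fun w _ ↦ hfinite (hf w).1.ne_zero
  rw [Filter.eventually_cofinite]
  refine (hSℓ.union hSB).subset fun v hv ↦ ?_
  by_contra hbad
  simp only [Set.mem_union, Set.mem_setOf_eq, Set.mem_iUnion, exists_prop, not_or,
    not_exists, not_and] at hbad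
  obtain ⟨hvℓ, hvB⟩ := hbad
  apply hv
  -- the rational prime below `v` is good: `≠ ℓ`, and `π` is unramified above it
  have hq := hf v
  have hqℓ : f v ≠ ℓ := fun h ↦ hvℓ (h ▸ hq.2)
  have hunr : π.1.IsUnramifiedAbove (f v) := by
    intro w hw
    by_contra hwr
    have hfw : f w = f v := natPrime_eq_of_natCast_mem (hf w).1 hq.1 (hf w).2 hw
    exact hvB w hwr (hfw ▸ hq.2)
  obtain ⟨α, hα⟩ := hunr v hq.2
  obtain ⟨hur, hPr⟩ := hc (f v) hq.1 hqℓ hunr v hq.2 α hα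
  obtain ⟨hur', hPr'⟩ := hc' (f v) hq.1 hqℓ hunr v hq.2 α hα
  exact ⟨hur, hur', _, hPr, hPr'⟩

end HarrisLanTaylorThorne2016

end Literature.NumberTheory.Automorphic
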